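import Summits.ResolutionOfSingularities.ResolutionOfSingularities.Theorems.EquisingularLiftEquisingularLiftNatClusterLiftTwoPoints
import Mathlib
import HarnessLib

/-!
# [OURS · L1 W4.5(b)] T-CLUSTER-LIFT part 4 — FAT POINTS IMPOSE INDEPENDENT CONDITIONS IN DEGREE `d ≥ Σ m_t − 1`: finitely many
# distinct points of one chart with `Σ_t m_t ≤ d + 1` are never superabundant; hence the lift of order `≥ m_t` along EVERY section
# of such a cluster exists unconditionally (crux `EquisingularLiftNat` = stmt-ResolutionOfSingularities-20038, line `sections`; v7′)

NOT a statement of any manuscript. Helper file of the chain res-L1-w45b (cell `res-hironaka`, LADDER-RESOLUTION rung L, slot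
W4.5(b)); OURS; AI-written, weaker than expert review; `--supports stmt-ResolutionOfSingularities-20038 --as helper` by
res-L1-w45b-stub-3 (object T-CLUSTER-LIFT, part 4). No `sorry`; standard axioms.

WHAT. Part 1 (…NatClusterLift): the lift through a cluster of sections under the downstairs INDEPENDENCE hypothesis `hind`. Parts 2–3:
`hind` for one point (`m ≤ d + 1`) and two points (`m₁ + m₂ ≤ d + 1`). This file: the classical general bound — ANY finite set of
distinct points `a_t` (`t ∈ ι`) of one chart with multiplicities `m_t` and **`Σ_t m_t ≤ d + 1`** imposes independent conditions on
the degree-`d` forms (regularity of a fat point scheme is at most `Σ m_t`; folklore, e.g. Davis–Geramita-type bounds — here proved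
directly: `g = Σ_t (∏_{t' ≠ t} ℓ_{t,t'}^{m_{t'}}) · h_t` with separating linear forms `ℓ_{t,t'}` (`= 0` at `a_{t'}`, `= 1` at `a_t`),
each product a UNIT modulo `𝔪_{a_t}^{m_t}`, and `h_t` of degree `d − Σ_{t'≠t} m_{t'} ≥ m_t − 1` from part 2):

* `exists_linearForm_sep` — for `a ≠ b` on the chart `i`: a linear form `ℓ` with `ℓ(T_i := 1) ∈ 𝔪_b` and `ℓ(T_i := 1) − 1 ∈ 𝔪_a`;
* `exists_isHomogeneous_mk_eq_and_forall_mem` — prescribed class mod `𝔪_{a_t}^{m_t}` at ONE point `t`, inside `𝔪_{a_{t'}}^{m_{t'}}`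
  at every other point;
* **`exists_isHomogeneous_forall_mk_dehomogenize_eq`** — all classes prescribed at once (sum over `t`);
* **`exists_isHomogeneous_forall_coeff_eq_manyPoints`** — jet currency = part 1's `hind` VERBATIM for the cluster
  (`i := fun _ => i₀`, injective `ā`, `Σ m_t ≤ d + 1`);
* **`exists_isHomogeneous_lift_forall_dehomogenize_mem_pow_of_sum_le`** — THE LIFT: `π : O ↠ k` onto a field, `ker π ≤ jacobson ⊥`,
  sections `a_t` on one chart with pairwise distinct reductions, `Σ m_t ≤ d + 1`, `g` a degree-`d` form of order `≥ m_t` at each `ā_t`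
  ⇒ a degree-`d` form `G` over `O`, `map π G = g`, of order `≥ m_t` along EVERY section `a_t` — no incidence condition at all in this
  range (beyond it, part 1's `hind` is a genuine hypothesis: F₇⁻ has `Σ m_t = 21 > 8`).

References: parts 1–3. res-L1-w45b-lead-2 LEAD-MEMO-5 §A (v7′ TC⁺⁺); res-L1-w45b-tri-1 XDERIVE-M1 Y3(ii) (OURS planning texts, index only).
-/

set_option linter.dupNamespace false -- mandated namespace `Summit.<Summit>.<Problem>` of this single-conjunct summit

noncomputable section

open MvPolynomial Literature.AlgebraicGeometry.Resolution

namespace Summit.ResolutionOfSingularities.ResolutionOfSingularities.Theorems.EquisingularLiftNat.ClusterLift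

section ManyPoints

variable {k : Type*} [Field k] {σ : Type*} [Finite σ] [DecidableEq σ] (i : σ)

omit [Finite σ] in
/-- **Separating linear form.** For distinct points `a ≠ b` of the chart `i` there is a linear form `ℓ` with `ℓ(T_i := 1) ∈ 𝔪_b`
and `ℓ(T_i := 1) ≡ 1 (mod 𝔪_a)`: `ℓ = (a_j − b_j)⁻¹ (T_j − b_j T_i)` for a coordinate `j` with `a_j ≠ b_j`. [folklore] -/
theorem exists_linearForm_sep (a b : {j : σ // j ≠ i} → k) (hab : a ≠ b) :
    ∃ ℓ : MvPolynomial σ k, ℓ.IsHomogeneous 1 ∧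
      dehomogenize i ℓ ∈ Ideal.span (Set.range fun j => (X j : MvPolynomial {j : σ // j ≠ i} k) - C (b j)) ∧
      dehomogenize i ℓ - 1 ∈ Ideal.span (Set.range fun j => (X j : MvPolynomial {j : σ // j ≠ i} k) - C (a j)) := by
  obtain ⟨j, hj⟩ := Function.ne_iff.mp hab
  have hc : (a j - b j)⁻¹ * (a j - b j) = 1 := inv_mul_cancel₀ (sub_ne_zero.mpr hj)
  refine ⟨C (a j - b j)⁻¹ * (X j.1 - C (b j) * X i), ?_, ?_, ?_⟩
  · have h1 : ((X j.1 : MvPolynomial σ k) - C (b j) * X i).IsHomogeneous 1 :=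
      (isHomogeneous_X k j.1).sub (by simpa using (isHomogeneous_C σ (b j)).mul (isHomogeneous_X k i))
    simpa using (isHomogeneous_C σ (a j - b j)⁻¹).mul h1
  · simp only [map_mul, map_sub, algHom_C, MvPolynomial.algebraMap_eq, dehomogenize_X_self, dehomogenize_X_val, mul_one]
    exact Ideal.mul_mem_left _ _ (Ideal.subset_span ⟨j, rfl⟩)
  · simp only [map_mul, map_sub, algHom_C, MvPolynomial.algebraMap_eq, dehomogenize_X_self, dehomogenize_X_val, mul_one]
    have hC : C (a j - b j)⁻¹ * (C (a j) - C (b j)) = (1 : MvPolynomial {j : σ // j ≠ i} k) := by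
      rw [← map_sub, ← map_mul, hc, map_one]
    have : C (a j - b j)⁻¹ * ((X j : MvPolynomial {j : σ // j ≠ i} k) - C (b j)) - 1 = C (a j - b j)⁻¹ * (X j - C (a j)) := by
      linear_combination hC
    rw [this]
    exact Ideal.mul_mem_left _ _ (Ideal.subset_span ⟨j, rfl⟩)

variable {ι : Type*} [Fintype ι] [DecidableEq ι]

/-- **Prescribed class at `a_t`, inside `𝔪_{a_{t'}}^{m_{t'}}` at every other point.** Distinct points `a : ι → (chart i)`,
`Σ_t m_t ≤ d + 1`: for each `t` and each class `c` modulo `𝔪_{a_t}^{m_t}` there is a degree-`d` form `g` with `g(T_i := 1) ≡ c` there and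
`g(T_i := 1) ∈ 𝔪_{a_{t'}}^{m_{t'}}` for all `t' ≠ t` (`g = (∏_{t'≠t} ℓ_{t,t'}^{m_{t'}}) · h`). [OURS · L1 W4.5b] -/
theorem exists_isHomogeneous_mk_eq_and_forall_mem (a : ι → {j : σ // j ≠ i} → k) (ha : Function.Injective a)
    (m : ι → ℕ) {d : ℕ} (hd : ∑ t, m t ≤ d + 1) (t : ι)
    (c : MvPolynomial {j : σ // j ≠ i} k ⧸
      (Ideal.span (Set.range fun j => (X j : MvPolynomial {j : σ // j ≠ i} k) - C (a t j))) ^ m t) :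
    ∃ g : MvPolynomial σ k, g.IsHomogeneous d ∧
      Ideal.Quotient.mk ((Ideal.span (Set.range fun j => (X j : MvPolynomial {j : σ // j ≠ i} k) - C (a t j))) ^ m t)
          (dehomogenize i g) = c ∧
        ∀ t', t' ≠ t → dehomogenize i g ∈
          (Ideal.span (Set.range fun j => (X j : MvPolynomial {j : σ // j ≠ i} k) - C (a t' j))) ^ m t' := by
  rcases Nat.eq_zero_or_pos (m t) with h0 | hpos
  · -- no condition at `a_t`: take `g = 0`
    haveI : Subsingleton (MvPolynomial {j : σ // j ≠ i} k ⧸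
        (Ideal.span (Set.range fun j => (X j : MvPolynomial {j : σ // j ≠ i} k) - C (a t j))) ^ m t) :=
      Ideal.Quotient.subsingleton_iff.mpr (by rw [h0, pow_zero, Ideal.one_eq_top])
    exact ⟨0, isHomogeneous_zero σ k d, Subsingleton.elim _ _, fun t' _ => by rw [map_zero]; exact Submodule.zero_mem _⟩
  -- the budget of the other points
  have hsplit : ∑ t' ∈ Finset.univ.erase t, m t' + m t = ∑ t', m t' := Finset.sum_erase_add _ _ (Finset.mem_univ t)
  set e : ℕ := ∑ t' ∈ Finset.univ.erase t, m t' with he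
  have hed : e ≤ d := by omega
  -- separating forms
  have hsep : ∀ t' : ι, t' ≠ t → ∃ ℓ : MvPolynomial σ k, ℓ.IsHomogeneous 1 ∧
      dehomogenize i ℓ ∈ Ideal.span (Set.range fun j => (X j : MvPolynomial {j : σ // j ≠ i} k) - C (a t' j)) ∧
      dehomogenize i ℓ - 1 ∈ Ideal.span (Set.range fun j => (X j : MvPolynomial {j : σ // j ≠ i} k) - C (a t j)) :=
    fun t' ht' => exists_linearForm_sep i (a t) (a t') (fun h => ht' (ha h).symm)
  choose! ℓ hℓhom hℓmem hℓone using hsep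
  -- the product `L = ∏_{t' ≠ t} ℓ_{t'}^{m_{t'}}`
  set L : MvPolynomial σ k := ∏ t' ∈ Finset.univ.erase t, ℓ t' ^ m t' with hL
  have hLhom : L.IsHomogeneous e := by
    rw [hL, he]
    refine IsHomogeneous.prod _ _ _ fun t' ht' => ?_
    simpa using (hℓhom t' (Finset.ne_of_mem_erase ht')).pow (m t')
  have hLmem : ∀ t', t' ≠ t → dehomogenize i L ∈
      (Ideal.span (Set.range fun j => (X j : MvPolynomial {j : σ // j ≠ i} k) - C (a t' j))) ^ m t' := by
    intro t' ht'
    rw [hL, map_prod, ← Finset.mul_prod_erase _ _ (Finset.mem_erase.mpr ⟨ht', Finset.mem_univ t'⟩), map_pow]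
    exact Ideal.mul_mem_right _ _ (Ideal.pow_mem_pow (hℓmem t' ht') (m t'))
  obtain ⟨u, hu⟩ : IsUnit (Ideal.Quotient.mk
      ((Ideal.span (Set.range fun j => (X j : MvPolynomial {j : σ // j ≠ i} k) - C (a t j))) ^ m t) (dehomogenize i L)) := by
    rw [hL, map_prod, map_prod]
    refine Finset.prod_induction _ _ (fun x y hx hy => hx.mul hy) isUnit_one fun t' ht' => ?_
    rw [map_pow, map_pow]
    exact (isUnit_mk_pow_of_sub_one_mem _ (m t) (hℓone t' (Finset.ne_of_mem_erase ht'))).pow _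
  obtain ⟨h, hh, hhc⟩ := exists_isHomogeneous_mk_dehomogenize_eq i (a t) (m := m t) (d := d - e) (by omega) (↑u⁻¹ * c)
  refine ⟨L * h, ?_, ?_, fun t' ht' => ?_⟩
  · have := hLhom.mul hh
    rwa [Nat.add_sub_cancel' hed] at this
  · rw [map_mul, map_mul, hhc, ← hu, Units.mul_inv_cancel_left]
  · rw [map_mul]
    exact Ideal.mul_mem_right _ _ (hLmem t' ht')

/-- **FAT POINTS IMPOSE INDEPENDENT CONDITIONS IN DEGREE `d ≥ Σ m_t − 1` (quotient currency).** Distinct points `a_t` of the chart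
`i` over a field, `Σ_t m_t ≤ d + 1`: every family of classes `c_t` modulo `𝔪_{a_t}^{m_t}` is realised by `g(T_i := 1)` for ONE
degree-`d` form `g` (the sum of the forms of `exists_isHomogeneous_mk_eq_and_forall_mem`). [folklore] [OURS · L1 W4.5b] -/
theorem exists_isHomogeneous_forall_mk_dehomogenize_eq (a : ι → {j : σ // j ≠ i} → k) (ha : Function.Injective a)
    (m : ι → ℕ) {d : ℕ} (hd : ∑ t, m t ≤ d + 1)
    (c : (t : ι) → MvPolynomial {j : σ // j ≠ i} k ⧸
      (Ideal.span (Set.range fun j => (X j : MvPolynomial {j : σ // j ≠ i} k) - C (a t j))) ^ m t) :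
    ∃ g : MvPolynomial σ k, g.IsHomogeneous d ∧ ∀ t,
      Ideal.Quotient.mk ((Ideal.span (Set.range fun j => (X j : MvPolynomial {j : σ // j ≠ i} k) - C (a t j))) ^ m t)
        (dehomogenize i g) = c t := by
  choose g hg hgc hgo using fun t => exists_isHomogeneous_mk_eq_and_forall_mem i a ha m hd t (c t)
  refine ⟨∑ t, g t, IsHomogeneous.sum _ _ _ (fun t _ => hg t), fun t => ?_⟩
  rw [map_sum, map_sum, ← Finset.add_sum_erase _ _ (Finset.mem_univ t), hgc t,
    Finset.sum_eq_zero (fun t' ht' => Ideal.Quotient.eq_zero_iff_mem.mpr (hgo t' t (Finset.ne_of_mem_erase ht').symm)), add_zero]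

/-- **FAT POINTS IMPOSE INDEPENDENT CONDITIONS IN DEGREE `d ≥ Σ m_t − 1`, jet currency** = part 1's INDEPENDENCE hypothesis `hind`
VERBATIM for a cluster of distinct points `ā_t` on one chart `i` (`i := fun _ => i`) with `Σ_t m_t ≤ d + 1`: every family of jets
(order `< m_t` at `a_t`) is the family of jets of ONE degree-`d` form. [folklore] [OURS · L1 W4.5b] -/
theorem exists_isHomogeneous_forall_coeff_eq_manyPoints (a : ι → {j : σ // j ≠ i} → k) (ha : Function.Injective a)
    (m : ι → ℕ) {d : ℕ} (hd : ∑ t, m t ≤ d + 1) (v : ι → ({j : σ // j ≠ i} →₀ ℕ) → k) :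
    ∃ g : MvPolynomial σ k, g.IsHomogeneous d ∧ ∀ t (α : {j : σ // j ≠ i} →₀ ℕ), α.degree < m t →
      coeff α (aeval (fun j => (X j : MvPolynomial {j : σ // j ≠ i} k) + C (a t j)) (dehomogenize i g)) = v t α := by
  classical
  haveI : ∀ t, Fintype {α : {j : σ // j ≠ i} →₀ ℕ // α.degree < m t} :=
    fun t => @Fintype.ofFinite _ (finite_subtype_degree_lt (m t))
  let S : ι → Finset ({j : σ // j ≠ i} →₀ ℕ) := fun t =>
    Finset.univ.map (Function.Embedding.subtype fun α : {j : σ // j ≠ i} →₀ ℕ => α.degree < m t)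
  have hS : ∀ t (α : {j : σ // j ≠ i} →₀ ℕ), α.degree < m t → α ∈ S t := fun t α hα => by
    simp only [S, Finset.mem_map, Finset.mem_univ, Function.Embedding.coe_subtype, true_and, Subtype.exists,
      exists_prop, exists_eq_right]; exact hα
  let J : ι → MvPolynomial {j : σ // j ≠ i} k := fun t =>
    aeval (fun l => (X l : MvPolynomial {j : σ // j ≠ i} k) - C (a t l)) (∑ β ∈ S t, monomial β (v t β))
  obtain ⟨g, hg, hgc⟩ := exists_isHomogeneous_forall_mk_dehomogenize_eq i a ha m hd
    fun t => Ideal.Quotient.mk _ (J t)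
  refine ⟨g, hg, fun t α hα => ?_⟩
  rw [coeff_eq_of_sub_mem_pow_span_X_sub_C (a t) (m t) (Ideal.Quotient.eq.mp (hgc t)) α hα]
  exact coeff_aeval_X_add_C_jetPoly (a t) (S t) (v t) (hS t α hα)

end ManyPoints

/-! ## The lift along a cluster of sections with `Σ m_t ≤ d + 1` -/

section ManyPointLift

variable {O k : Type*} [CommRing O] [Field k] (π : O →+* k) {σ : Type*} [Finite σ] [DecidableEq σ]
variable {ι : Type*} [Fintype ι] [DecidableEq ι]

/-- **THE LIFT OF ORDER `≥ m_t` ALONG EVERY SECTION OF A CLUSTER WITH `Σ m_t ≤ d + 1` — unconditionally.** `π : O ↠ k` onto a field,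
`ker π ≤ jacobson ⊥` (e.g. `O` local); sections `a_t` (`t ∈ ι`, finite) on the chart `i` with PAIRWISE DISTINCT reductions `ā_t`;
`Σ_t m_t ≤ d + 1`; `g ∈ k[T_σ]` a form of degree `d` of order `≥ m_t` at every `ā_t`. THEN there is a form `G ∈ O[T_σ]_d` with
`map π G = g` and `G(T_i := 1) ∈ 𝔪_{a_t}^{m_t}` for EVERY `t`. (Part 1 headline ∘ `exists_isHomogeneous_forall_coeff_eq_manyPoints`:
in this range the superabundance clause is automatically satisfied.) [OURS · L1 W4.5b] -/
theorem exists_isHomogeneous_lift_forall_dehomogenize_mem_pow_of_sum_le (hπ : Function.Surjective π)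
    (hker : RingHom.ker π ≤ (⊥ : Ideal O).jacobson) {d : ℕ} (i : σ) (a : ι → {j : σ // j ≠ i} → O)
    (ha : Function.Injective fun t => fun j => π (a t j)) (m : ι → ℕ) (hd : ∑ t, m t ≤ d + 1)
    (g : MvPolynomial σ k) (hg : g.IsHomogeneous d)
    (hgZ : ∀ t, dehomogenize i g ∈
      (Ideal.span (Set.range fun j => (X j : MvPolynomial {j : σ // j ≠ i} k) - C (π (a t j)))) ^ m t) :
    ∃ G : MvPolynomial σ O, G.IsHomogeneous d ∧ MvPolynomial.map π G = g ∧
      ∀ t, dehomogenize i G ∈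
        (Ideal.span (Set.range fun j => (X j : MvPolynomial {j : σ // j ≠ i} O) - C (a t j))) ^ m t :=
  exists_isHomogeneous_lift_forall_dehomogenize_mem_pow π hπ hker (fun _ => i) a m
    (fun v => exists_isHomogeneous_forall_coeff_eq_manyPoints i (fun t j => π (a t j)) ha m hd v) g hg hgZ

/-- **The cluster lift over a local ring** (the chain's DVR `O`, residue map `π : O ↠ k`). [OURS · L1 W4.5b] -/
theorem exists_isHomogeneous_lift_forall_dehomogenize_mem_pow_of_sum_le_of_isLocalRing [IsLocalRing O]
    (hπ : Function.Surjective π) {d : ℕ} (i : σ) (a : ι → {j : σ // j ≠ i} → O)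
    (ha : Function.Injective fun t => fun j => π (a t j)) (m : ι → ℕ) (hd : ∑ t, m t ≤ d + 1)
    (g : MvPolynomial σ k) (hg : g.IsHomogeneous d)
    (hgZ : ∀ t, dehomogenize i g ∈
      (Ideal.span (Set.range fun j => (X j : MvPolynomial {j : σ // j ≠ i} k) - C (π (a t j)))) ^ m t) :
    ∃ G : MvPolynomial σ O, G.IsHomogeneous d ∧ MvPolynomial.map π G = g ∧
      ∀ t, dehomogenize i G ∈
        (Ideal.span (Set.range fun j => (X j : MvPolynomial {j : σ // j ≠ i} O) - C (a t j))) ^ m t :=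
  exists_isHomogeneous_lift_forall_dehomogenize_mem_pow_of_sum_le π hπ (ker_le_jacobson_bot_of_isLocalRing π) i a ha m hd
    g hg hgZ

end ManyPointLift

end Summit.ResolutionOfSingularities.ResolutionOfSingularities.Theorems.EquisingularLiftNat.ClusterLift

end
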